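import Summits.RiemannHypothesis.RiemannHypothesis.Theorems.WeilFormatCWindowPolyProfile
import Summits.RiemannHypothesis.RiemannHypothesis.Theorems.WeilFormatCWindowGram
import Summits.RiemannHypothesis.RiemannHypothesis.Theorems.WeilFormatCEntryBasis
import HarnessLib

/-!
# Format C, design C∞: identification of the deflated-profile entries as limits of the finite Gram sums

Route context: Fourier–Galerkin / Schur-complement certificates of Weil positivity on a window ("format C";
cell memo `run/shared/lean/pub/rh-explicit/rh-explicit-weil-10/FORMATC-DESIGN.md` §9.12.9–§9.13, KERNEL-LEVER.md §17 (a);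
supporting stmt-RiemannHypothesis-0098; seat rh-explicit-weil-10).  In the deflated certificate the profiles enter through
their BAND partial sums `proj_P φ − proj_B φ` (Fourier modes `B ≤ |n| ≤ P` of the profile window `φ = 1_{[−a,a]}·f`), and
the limit wrapper (`WeilFormatCDeflatedFarLimit`) needs the ENTRYWISE limits `P → ∞` of the Gram entries built from them
(then `WeilFormatCDeflatedFarApprox.exists_blockQuadForm_approx` gives the uniform statement).  This file supplies them:

* `proj_sum_smul_chi_of_subset` — a trigonometric window `Σ_{n∈s} c_n χ_n` is fixed by `proj_P` once `s ⊆ modes P`;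
  its window-function / continuity / endpoint / coefficient-summability data;
* `tendsto_weilWindowSesq_trig_proj`, `…_proj_trig` — for such a window `u` and an admissible `v`:
  `W_a(u, proj_P v) → W_a(u, v)` and `W_a(proj_P v, u) → W_a(v, u)`;
* `weilWindowSesq_sub_left/right` and the BAND limits: `W_a(u, proj_P φ − proj_B φ) → W_a(u, φ − proj_B φ)` (block × profile
  entries) and `W_a(proj_P φ − proj_B φ, proj_P ψ − proj_B ψ) → W_a(φ − proj_B φ, ψ − proj_B ψ)` (profile × profile entries)
  for `C¹`-periodising `C³` profile windows `φ = 1f`, `ψ = 1g` (`tendsto_weilWindowSesq_trig_band_indicator`,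
  `tendsto_weilWindowSesq_band_band_indicator`).

The limits are then evaluated by the closed forms of `WeilFormatCPolyWindow{Entry,MixedEntry}.lean` and weil-2's
`weilWindowSesq_chi = gramCoeff`.  Pure bookkeeping; standard axioms; no RH claim.
-/

set_option autoImplicit false
-- `Summit.RiemannHypothesis.RiemannHypothesis.…` is the layout-mandated namespace (summit = problem name).
set_option linter.dupNamespace false

noncomputable section

open Complex Filter Set MeasureTheory
open scoped Real Topology ComplexConjugate

namespace Summit.RiemannHypothesis.RiemannHypothesis.Theorems.WeilFormatC

open Literature.NumberTheory.LFunctions Literature.NumberTheory.LFunctions.Yoshida1992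

variable {a : ℝ}

/-! ## Trigonometric windows are fixed by the projections -/

/-- A trigonometric window on modes `s ⊆ modes P` is reproduced by `proj_P` (`a > 0`). -/
theorem proj_sum_smul_chi_of_subset (ha : 0 < a) {s : Finset ℤ} {P : ℕ} (hs : s ⊆ modes P) (c : ℤ → ℂ) :
    proj a P (∑ n ∈ s, c n • chi a n) = ∑ n ∈ s, c n • chi a n := by
  unfold proj
  have hsq : (Real.sqrt (2 * a) : ℂ) ≠ 0 := by exact_mod_cast (Real.sqrt_pos.2 (by positivity)).ne'
  have e : ∀ m ∈ modes P,
      ((((1 / Real.sqrt (2 * a) : ℝ) : ℂ) * Yoshida1992.fourierCoeff a m (∑ n ∈ s, c n • chi a n)) • chi a m)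
        = if m ∈ s then c m • chi a m else 0 := by
    intro m _
    rw [fourierCoeff_sum_smul_chi ha s c m]
    split_ifs with hm
    · congr 1
      push_cast
      field_simp
    · rw [mul_zero, zero_smul]
  rw [Finset.sum_congr rfl e, Finset.sum_ite_mem, Finset.inter_eq_right.2 hs]

/-- Every finite set of modes lies in `modes P` for all large `P`. -/
theorem exists_subset_modes (s : Finset ℤ) : ∃ P₀ : ℕ, ∀ P, P₀ ≤ P → s ⊆ modes P := by
  refine ⟨s.sup fun n ↦ n.natAbs, fun P hP n hn ↦ ?_⟩
  rw [mem_modes]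
  have h1 : n.natAbs ≤ s.sup fun n ↦ n.natAbs := Finset.le_sup (f := fun n : ℤ ↦ n.natAbs) hn
  have : ((n.natAbs : ℕ) : ℤ) ≤ P := by exact_mod_cast h1.trans hP
  rwa [Int.natCast_natAbs] at this

/-- A trigonometric window is a window function (`a > 0`). -/
theorem isWindowFunction_sum_smul_chi (ha : 0 < a) (s : Finset ℤ) (c : ℤ → ℂ) :
    IsWindowFunction a (∑ n ∈ s, c n • chi a n) :=
  IsWindowFunction.sum s c fun n _ ↦ isWindowFunction_chi ha n

/-- A trigonometric window is continuous on the closed window. -/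
theorem continuousOn_sum_smul_chi (a : ℝ) (s : Finset ℤ) (c : ℤ → ℂ) :
    ContinuousOn (∑ n ∈ s, c n • chi a n) (Icc (-a) a) := by
  have hc : Continuous fun x ↦ ∑ n ∈ s, c n * chiCore a n x :=
    continuous_finsetSum _ fun n _ ↦ continuous_const.mul (continuous_chiCore a n)
  refine hc.continuousOn.congr fun x hx ↦ ?_
  rw [sum_smul_chi_apply]
  exact Finset.sum_congr rfl fun n _ ↦ by rw [chi_eq_chiCore_of_mem n hx]

/-- A trigonometric window takes the same value at `±a` (`a ≥ 0`; the cores are `2a`-periodic). -/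
theorem sum_smul_chi_neg_eq (ha : 0 ≤ a) (s : Finset ℤ) (c : ℤ → ℂ) :
    (∑ n ∈ s, c n • chi a n) (-a) = (∑ n ∈ s, c n • chi a n) a := by
  have hma : -a ∈ Icc (-a) a := left_mem_Icc.2 (by linarith)
  have hpa : a ∈ Icc (-a) a := right_mem_Icc.2 (by linarith)
  rw [sum_smul_chi_apply, sum_smul_chi_apply]
  refine Finset.sum_congr rfl fun n _ ↦ ?_
  rw [chi_eq_chiCore_of_mem n hma, chi_eq_chiCore_of_mem n hpa]
  have h := chiCore_periodic a n (-a)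
  rw [show -a + 2 * a = a by ring] at h
  rw [h]

/-- The window coefficients of a trigonometric window are finitely supported, hence summable against any weight. -/
theorem summable_weight_mul_norm_fourierCoeff_sum_smul_chi (ha : 0 < a) (s : Finset ℤ) (c : ℤ → ℂ) (w : ℤ → ℝ) :
    Summable fun n : ℤ ↦ w n * ‖Yoshida1992.fourierCoeff a n (∑ m ∈ s, c m • chi a m)‖ := by
  refine summable_of_ne_finset_zero (s := s) fun n hn ↦ ?_
  rw [fourierCoeff_sum_smul_chi ha s c n, if_neg hn, norm_zero, mul_zero]

/-! ## Trigonometric window against a projected admissible window -/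

/-- **`W_a(u, proj_P v) → W_a(u, v)`** for a trigonometric window `u = Σ_{n∈s} c_n χ_n` and a window function `v` of the
summable class (`a > 0`). -/
theorem tendsto_weilWindowSesq_trig_proj (ha : 0 < a) (s : Finset ℤ) (c : ℤ → ℂ) {v : ℝ → ℂ}
    (hv : IsWindowFunction a v) (hcv : ContinuousOn v (Icc (-a) a)) (hev : v (-a) = v a)
    (hsv0 : Summable fun n : ℤ ↦ ‖Yoshida1992.fourierCoeff a n v‖)
    (hsv1 : Summable fun n : ℤ ↦ |(n : ℝ)| ^ 1 * ‖Yoshida1992.fourierCoeff a n v‖) :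
    Tendsto (fun P ↦ weilWindowSesq a (∑ n ∈ s, c n • chi a n) (proj a P v)) atTop
      (𝓝 (weilWindowSesq a (∑ n ∈ s, c n • chi a n) v)) := by
  obtain ⟨P₀, hP₀⟩ := exists_subset_modes s
  have hsu0 := summable_weight_mul_norm_fourierCoeff_sum_smul_chi ha s c (fun _ ↦ 1)
  have hsu1 := summable_weight_mul_norm_fourierCoeff_sum_smul_chi ha s c (fun n ↦ |(n : ℝ)| ^ 1)
  simp only [one_mul] at hsu0
  have h := tendsto_weilWindowSesq_proj_of_summable ha (isWindowFunction_sum_smul_chi ha s c) hv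
    (continuousOn_sum_smul_chi a s c) hcv (sum_smul_chi_neg_eq ha.le s c) hev hsu0 hsu1 hsv0 hsv1
  refine h.congr' ?_
  filter_upwards [eventually_ge_atTop P₀] with P hP
  rw [proj_sum_smul_chi_of_subset ha (hP₀ P hP) c]

/-- **`W_a(proj_P v, u) → W_a(v, u)`** (the transposed statement). -/
theorem tendsto_weilWindowSesq_proj_trig (ha : 0 < a) (s : Finset ℤ) (c : ℤ → ℂ) {v : ℝ → ℂ}
    (hv : IsWindowFunction a v) (hcv : ContinuousOn v (Icc (-a) a)) (hev : v (-a) = v a)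
    (hsv0 : Summable fun n : ℤ ↦ ‖Yoshida1992.fourierCoeff a n v‖)
    (hsv1 : Summable fun n : ℤ ↦ |(n : ℝ)| ^ 1 * ‖Yoshida1992.fourierCoeff a n v‖) :
    Tendsto (fun P ↦ weilWindowSesq a (proj a P v) (∑ n ∈ s, c n • chi a n)) atTop
      (𝓝 (weilWindowSesq a v (∑ n ∈ s, c n • chi a n))) := by
  obtain ⟨P₀, hP₀⟩ := exists_subset_modes s
  have hsu0 := summable_weight_mul_norm_fourierCoeff_sum_smul_chi ha s c (fun _ ↦ 1)
  have hsu1 := summable_weight_mul_norm_fourierCoeff_sum_smul_chi ha s c (fun n ↦ |(n : ℝ)| ^ 1)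
  simp only [one_mul] at hsu0
  have h := tendsto_weilWindowSesq_proj_of_summable ha hv (isWindowFunction_sum_smul_chi ha s c) hcv
    (continuousOn_sum_smul_chi a s c) hev (sum_smul_chi_neg_eq ha.le s c) hsv0 hsv1 hsu0 hsu1
  refine h.congr' ?_
  filter_upwards [eventually_ge_atTop P₀] with P hP
  rw [proj_sum_smul_chi_of_subset ha (hP₀ P hP) c]

/-! ## Admissible profile windows: the data of the summable class -/

/-- The summable-class data of a `C¹`-periodising `C³` profile window `1f` (`a > 0`): window function, continuity on the
closed window, matching endpoint values, and the two coefficient summabilities. -/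
theorem summableClass_indicator_of_contDiff (ha : 0 < a) {f : ℝ → ℂ} (hf : ContDiff ℝ 3 f) (hfe₀ : f (-a) = f a)
    (hfe₁ : deriv f (-a) = deriv f a) :
    IsWindowFunction a ((Icc (-a) a).indicator f) ∧ ContinuousOn ((Icc (-a) a).indicator f) (Icc (-a) a) ∧
      ((Icc (-a) a).indicator f) (-a) = ((Icc (-a) a).indicator f) a ∧
      (Summable fun n : ℤ ↦ ‖Yoshida1992.fourierCoeff a n ((Icc (-a) a).indicator f)‖) ∧
      (Summable fun n : ℤ ↦ |(n : ℝ)| ^ 1 * ‖Yoshida1992.fourierCoeff a n ((Icc (-a) a).indicator f)‖) := by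
  obtain ⟨hf₀, hf₁, hf₂, hf₃⟩ := hasDerivAt_iteratedDeriv_of_contDiff_three hf
  rw [← iteratedDeriv_one] at hfe₁
  have hcf : Continuous f := hf.continuous
  have hc₁ : Continuous (iteratedDeriv 1 f) := continuous_iff_continuousAt.2 fun x ↦ (hf₁ x).continuousAt
  have hma : -a ∈ Icc (-a) a := left_mem_Icc.2 (by linarith)
  have hpa : a ∈ Icc (-a) a := right_mem_Icc.2 (by linarith)
  obtain ⟨hs0, hs1⟩ := summable_norm_fourierCoeff_of_C1_periodising ha hf₀ hf₁ hf₂ hf₃ hfe₀ hfe₁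
  refine ⟨isWindowFunction_indicator_of_hasDerivAt a hf₀ hc₁, hcf.continuousOn.congr fun x hx ↦ indicator_of_mem hx f,
    ?_, ?_, ?_⟩
  · rw [indicator_of_mem hma, indicator_of_mem hpa, hfe₀]
  · simpa only [fourierCoeff_indicator ha.le] using hs0
  · simpa only [fourierCoeff_indicator ha.le] using hs1

/-- `W_a(u, proj_P (1f)) → W_a(u, 1f)` for a trigonometric window `u` and an admissible profile `f`. -/
theorem tendsto_weilWindowSesq_trig_proj_indicator (ha : 0 < a) (s : Finset ℤ) (c : ℤ → ℂ) {f : ℝ → ℂ}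
    (hf : ContDiff ℝ 3 f) (hfe₀ : f (-a) = f a) (hfe₁ : deriv f (-a) = deriv f a) :
    Tendsto (fun P ↦ weilWindowSesq a (∑ n ∈ s, c n • chi a n) (proj a P ((Icc (-a) a).indicator f))) atTop
      (𝓝 (weilWindowSesq a (∑ n ∈ s, c n • chi a n) ((Icc (-a) a).indicator f))) := by
  obtain ⟨hv, hcv, hev, hsv0, hsv1⟩ := summableClass_indicator_of_contDiff ha hf hfe₀ hfe₁
  exact tendsto_weilWindowSesq_trig_proj ha s c hv hcv hev hsv0 hsv1

/-- `W_a(proj_P (1f), u) → W_a(1f, u)` for a trigonometric window `u` and an admissible profile `f`. -/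
theorem tendsto_weilWindowSesq_proj_indicator_trig (ha : 0 < a) (s : Finset ℤ) (c : ℤ → ℂ) {f : ℝ → ℂ}
    (hf : ContDiff ℝ 3 f) (hfe₀ : f (-a) = f a) (hfe₁ : deriv f (-a) = deriv f a) :
    Tendsto (fun P ↦ weilWindowSesq a (proj a P ((Icc (-a) a).indicator f)) (∑ n ∈ s, c n • chi a n)) atTop
      (𝓝 (weilWindowSesq a ((Icc (-a) a).indicator f) (∑ n ∈ s, c n • chi a n))) := by
  obtain ⟨hv, hcv, hev, hsv0, hsv1⟩ := summableClass_indicator_of_contDiff ha hf hfe₀ hfe₁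
  exact tendsto_weilWindowSesq_proj_trig ha s c hv hcv hev hsv0 hsv1

/-! ## Bands `proj_P − proj_B` -/

/-- Window functions are closed under subtraction. -/
theorem IsWindowFunction.sub {u v : ℝ → ℂ} (hu : IsWindowFunction a u) (hv : IsWindowFunction a v) :
    IsWindowFunction a (u - v) := by
  have h := hu.add (hv.smul (-1))
  have e : u + (-1 : ℂ) • v = u - v := by rw [neg_one_smul, ← sub_eq_add_neg]
  rwa [e] at h

/-- Subtraction in the second argument (window functions, `a ≥ 0`). -/
theorem weilWindowSesq_sub_right (ha : 0 ≤ a) {u v₁ v₂ : ℝ → ℂ} (hu : IsWindowFunction a u)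
    (hv₁ : IsWindowFunction a v₁) (hv₂ : IsWindowFunction a v₂) :
    weilWindowSesq a u (v₁ - v₂) = weilWindowSesq a u v₁ - weilWindowSesq a u v₂ := by
  rw [sub_eq_add_neg, show -v₂ = (-1 : ℂ) • v₂ by rw [neg_one_smul], weilWindowSesq_add_right ha hu hv₁ (hv₂.smul _),
    weilWindowSesq_smul_right, map_neg, map_one]
  ring

/-- Subtraction in the first argument (window functions, `a ≥ 0`). -/
theorem weilWindowSesq_sub_left (ha : 0 ≤ a) {u₁ u₂ v : ℝ → ℂ} (hu₁ : IsWindowFunction a u₁)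
    (hu₂ : IsWindowFunction a u₂) (hv : IsWindowFunction a v) :
    weilWindowSesq a (u₁ - u₂) v = weilWindowSesq a u₁ v - weilWindowSesq a u₂ v := by
  rw [sub_eq_add_neg, show -u₂ = (-1 : ℂ) • u₂ by rw [neg_one_smul], weilWindowSesq_add_left ha hu₁ (hu₂.smul _) hv,
    weilWindowSesq_smul_left]
  ring

/-- **Block × profile entries: the band limit.**  For a trigonometric window `u` and an admissible profile `f`:
`W_a(u, proj_P(1f) − proj_B(1f)) → W_a(u, 1f − proj_B(1f))` as `P → ∞`. -/
theorem tendsto_weilWindowSesq_trig_band_indicator (ha : 0 < a) (s : Finset ℤ) (c : ℤ → ℂ) {f : ℝ → ℂ}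
    (hf : ContDiff ℝ 3 f) (hfe₀ : f (-a) = f a) (hfe₁ : deriv f (-a) = deriv f a) (B : ℕ) :
    Tendsto (fun P ↦ weilWindowSesq a (∑ n ∈ s, c n • chi a n)
        (proj a P ((Icc (-a) a).indicator f) - proj a B ((Icc (-a) a).indicator f))) atTop
      (𝓝 (weilWindowSesq a (∑ n ∈ s, c n • chi a n)
        ((Icc (-a) a).indicator f - proj a B ((Icc (-a) a).indicator f)))) := by
  obtain ⟨hv, -, -, -, -⟩ := summableClass_indicator_of_contDiff ha hf hfe₀ hfe₁
  have hu := isWindowFunction_sum_smul_chi ha s c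
  have e : (fun P ↦ weilWindowSesq a (∑ n ∈ s, c n • chi a n)
      (proj a P ((Icc (-a) a).indicator f) - proj a B ((Icc (-a) a).indicator f))) =
      fun P ↦ weilWindowSesq a (∑ n ∈ s, c n • chi a n) (proj a P ((Icc (-a) a).indicator f)) -
        weilWindowSesq a (∑ n ∈ s, c n • chi a n) (proj a B ((Icc (-a) a).indicator f)) :=
    funext fun P ↦ weilWindowSesq_sub_right ha.le hu (isWindowFunction_proj ha P _) (isWindowFunction_proj ha B _)
  rw [e, weilWindowSesq_sub_right ha.le hu hv (isWindowFunction_proj ha B _)]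
  exact (tendsto_weilWindowSesq_trig_proj_indicator ha s c hf hfe₀ hfe₁).sub_const _

/-- **Profile × profile entries: the band limit.**  For admissible profiles `f, g`:
`W_a(proj_P(1f) − proj_B(1f), proj_P(1g) − proj_B(1g)) → W_a(1f − proj_B(1f), 1g − proj_B(1g))` as `P → ∞`. -/
theorem tendsto_weilWindowSesq_band_band_indicator (ha : 0 < a) {f g : ℝ → ℂ}
    (hf : ContDiff ℝ 3 f) (hfe₀ : f (-a) = f a) (hfe₁ : deriv f (-a) = deriv f a)
    (hg : ContDiff ℝ 3 g) (hge₀ : g (-a) = g a) (hge₁ : deriv g (-a) = deriv g a) (B : ℕ) :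
    Tendsto (fun P ↦ weilWindowSesq a
        (proj a P ((Icc (-a) a).indicator f) - proj a B ((Icc (-a) a).indicator f))
        (proj a P ((Icc (-a) a).indicator g) - proj a B ((Icc (-a) a).indicator g))) atTop
      (𝓝 (weilWindowSesq a ((Icc (-a) a).indicator f - proj a B ((Icc (-a) a).indicator f))
        ((Icc (-a) a).indicator g - proj a B ((Icc (-a) a).indicator g)))) := by
  set φ := (Icc (-a) a).indicator f with hφ
  set ψ := (Icc (-a) a).indicator g with hψ
  obtain ⟨hvf, -, -, -, -⟩ := summableClass_indicator_of_contDiff ha hf hfe₀ hfe₁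
  obtain ⟨hvg, -, -, -, -⟩ := summableClass_indicator_of_contDiff ha hg hge₀ hge₁
  have hPf : ∀ P : ℕ, IsWindowFunction a (proj a P φ) := fun P ↦ isWindowFunction_proj ha P _
  have hPg : ∀ P : ℕ, IsWindowFunction a (proj a P ψ) := fun P ↦ isWindowFunction_proj ha P _
  -- expand both sides into four terms
  have e : ∀ P : ℕ, weilWindowSesq a (proj a P φ - proj a B φ) (proj a P ψ - proj a B ψ) =
      weilWindowSesq a (proj a P φ) (proj a P ψ) - weilWindowSesq a (proj a P φ) (proj a B ψ) -
        (weilWindowSesq a (proj a B φ) (proj a P ψ) - weilWindowSesq a (proj a B φ) (proj a B ψ)) := by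
    intro P
    rw [weilWindowSesq_sub_left ha.le (hPf P) (hPf B) ((hPg P).sub (hPg B)),
      weilWindowSesq_sub_right ha.le (hPf P) (hPg P) (hPg B), weilWindowSesq_sub_right ha.le (hPf B) (hPg P) (hPg B)]
  have elim : weilWindowSesq a (φ - proj a B φ) (ψ - proj a B ψ) =
      weilWindowSesq a φ ψ - weilWindowSesq a φ (proj a B ψ) -
        (weilWindowSesq a (proj a B φ) ψ - weilWindowSesq a (proj a B φ) (proj a B ψ)) := by
    rw [weilWindowSesq_sub_left ha.le hvf (hPf B) (hvg.sub (hPg B)),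
      weilWindowSesq_sub_right ha.le hvf hvg (hPg B), weilWindowSesq_sub_right ha.le (hPf B) hvg (hPg B)]
  simp_rw [e]
  rw [elim]
  have t1 : Tendsto (fun P ↦ weilWindowSesq a (proj a P φ) (proj a P ψ)) atTop (𝓝 (weilWindowSesq a φ ψ)) :=
    tendsto_weilWindowSesq_proj_indicator_of_contDiff ha hf hg hfe₀ hfe₁ hge₀ hge₁
  have t2 : Tendsto (fun P ↦ weilWindowSesq a (proj a P φ) (proj a B ψ)) atTop (𝓝 (weilWindowSesq a φ (proj a B ψ))) :=
    tendsto_weilWindowSesq_proj_indicator_trig ha (modes B) _ hf hfe₀ hfe₁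
  have t3 : Tendsto (fun P ↦ weilWindowSesq a (proj a B φ) (proj a P ψ)) atTop (𝓝 (weilWindowSesq a (proj a B φ) ψ)) :=
    tendsto_weilWindowSesq_trig_proj_indicator ha (modes B) _ hg hge₀ hge₁
  exact (t1.sub t2).sub (t3.sub_const _)

end Summit.RiemannHypothesis.RiemannHypothesis.Theorems.WeilFormatC

end
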